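import Summits.QuantumFields.BalabanUV.Beta.SecondOrderStepRemainder

/-!
# `BalabanUV.Beta.SecondOrderLetterParity` — binder row D1, (L4): **THE PARITY SPLIT OF A FULL-KERNEL LETTER** (owner NOTE X-an2-47-K): a
# letter `L = C + R` between row-parity-graded kernels splits into its even and odd parts — if `L` and `R` are odd and `C` is even then
# `C = 0` (no model unless the similarity term vanishes); if `L` and `C` are even and `R` is odd then `R = 0` (the letter is EXACT) — and the
# commutator of a parity-ODD table with a diagonal kernel is parity-EVEN (the twin of leaf-05's `parityOdd_conjV_diagK_of_even`)
# (β sub-cell, row BETA-an2 = BINDER-OWNERS row D1 OWNER, lineage an2 gen 19)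

HONEST FRAMING (cell charter, verbatim): «discharging BetaPertH makes Balaban's UV stability UNCONDITIONAL — a real
constructive-QFT result; it is NOT the continuum limit and NOT the Clay problem.»  Neutral kernel algebra ([folklore]), entrywise; no statement of
Bałaban's papers, no `[cite:]`, no `def`, no `Prop` fact; instantiates no binder of the wall.  NOT D1, NOT `BetaPertH`, NOT continuum, NOT Clay.

READING (asserted nowhere beyond the lemmas): the hW END's border Ward letters (`WardLocusRecursiveLetters.…_of_letters` p219370, hBord0/hBordS) are
full-kernel equations `L = [c′ • vhSAt′, D] + RB` with `L` a finite combination of the border table `vh₂S` (so of ITS parity), `vhSAt` parity-odd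
(`trK_vhSAt`), `D` diagonal, `RB` odd: by `parityEven_conjV_diagK_of_odd` the commutator is EVEN, so a TWIN (odd) `vh₂S` forces it to vanish
(`even_eq_zero_of_odd_letter`) — no twin model — while an ANTI-TWIN (even) `vh₂S` forces `RB = 0` (`odd_eq_zero_of_even_letter`): the same verdict
as the hR side's X-an2-46 (`SecondOrderBorderNoModel`, `SecondOrderBorderNoModelWitness`).
Provenance: β sub-cell, unit beta-an2 gen 19, 2026-08-20 (v1); no existing file touched.
-/

open Literature.MathematicalPhysics.QuantumFieldTheory.Balaban1983to89
open Literature.MathematicalPhysics.QuantumFieldTheory.Balaban1983to89.Beta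
open ExpKernelCalculus (MKer)
open OneStepResolventKernel (Fib)
open Summit.QuantumFields.BalabanUV.Beta.TameKernelCalculus
open Summit.QuantumFields.BalabanUV.Beta.BorderedHessian (sgnK sgnK_apply sgnK_sgnK diagK conjV_diagK_apply)
open Summit.QuantumFields.BalabanUV.Beta.ChartConjugation (conjV)
open Summit.QuantumFields.BalabanUV.Beta.KernelWardRemainderParity (sgnK_add)

namespace Summit.QuantumFields.BalabanUV.Beta.SecondOrderLetterParity

noncomputable section

variable {d : ℕ}

/-- [folklore] A kernel that is both parity-even and parity-odd vanishes. -/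
theorem eq_zero_of_even_of_odd {K : MKer (d + 1) (Fib d)} (he : trK K = sgnK K) (ho : trK K = -sgnK K) : K = 0 := by
  have h2 : sgnK K = 0 := by
    have : sgnK K = -sgnK K := he.symm.trans ho
    funext x z a b
    have e := congrFun (congrFun (congrFun (congrFun this x) z) a) b
    simp only [Pi.neg_apply, Pi.zero_apply] at e ⊢
    linarith
  have := congrArg sgnK h2
  rw [sgnK_sgnK] at this
  rw [this]
  funext x z a b
  simp [sgnK_apply]

/-- [folklore] **ODD LETTER, EVEN SIMILARITY TERM ⇒ THE SIMILARITY TERM VANISHES**: `L = C + R` with `L`, `R` row-parity-odd and `C`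
row-parity-even forces `C = 0` (and `L = R`). -/
theorem even_eq_zero_of_odd_letter {L C R : MKer (d + 1) (Fib d)} (hL : trK L = -sgnK L) (hC : trK C = sgnK C) (hR : trK R = -sgnK R)
    (h : L = C + R) : C = 0 := by
  have hC' : trK C = -sgnK C := by
    have e1 : trK L = trK C + trK R := by rw [h]; rfl
    rw [hL, hC, hR, h, sgnK_add] at e1
    -- `-(sC + sR) = sC - sR` ⇒ `sC = -sC`
    have : sgnK C = -sgnK C := by
      have e2 := e1
      funext x z a b
      have e := congrFun (congrFun (congrFun (congrFun e2 x) z) a) b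
      simp only [Pi.neg_apply, Pi.add_apply] at e ⊢
      linarith
    rw [hC]; exact this
  exact eq_zero_of_even_of_odd hC hC'

/-- [folklore] **EVEN LETTER, ODD RESIDUAL ⇒ THE RESIDUAL VANISHES**: `L = C + R` with `L`, `C` row-parity-even and `R` row-parity-odd forces
`R = 0` (the letter is EXACT, `L = C`). -/
theorem odd_eq_zero_of_even_letter {L C R : MKer (d + 1) (Fib d)} (hL : trK L = sgnK L) (hC : trK C = sgnK C) (hR : trK R = -sgnK R)
    (h : L = C + R) : R = 0 := by
  have hR' : trK R = sgnK R := by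
    have e1 : trK L = trK C + trK R := by rw [h]; rfl
    rw [hL, hC, hR, h, sgnK_add] at e1
    have : sgnK R = -sgnK R := by
      funext x z a b
      have e := congrFun (congrFun (congrFun (congrFun e1 x) z) a) b
      simp only [Pi.neg_apply, Pi.add_apply] at e ⊢
      linarith
    rw [hR]; exact this.symm
  exact eq_zero_of_even_of_odd hR' hR

/-- [folklore] **THE COMMUTATOR OF A PARITY-ODD KERNEL WITH A DIAGONAL KERNEL IS PARITY-EVEN** (twin of
`SecondOrderStepRemainder.parityOdd_conjV_diagK_of_even`): `trK (conjV S (diagK g)) = sgnK (conjV S (diagK g))` for `trK S = −sgnK S`. -/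
theorem parityEven_conjV_diagK_of_odd (g : (Fin (d + 1) → ℤ) → Fib d → ℝ) {S : MKer (d + 1) (Fib d)} (h : trK S = -sgnK S) :
    trK (conjV S (diagK g)) = sgnK (conjV S (diagK g)) := by
  funext x z a b
  have e := congrArg (fun K => K x z a b) h
  simp only [trK_apply, Pi.neg_apply, sgnK_apply] at e
  simp only [trK_apply, sgnK_apply]
  rw [conjV_diagK_apply, conjV_diagK_apply, e]
  ring

end

end Summit.QuantumFields.BalabanUV.Beta.SecondOrderLetterParity
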